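import Summits.AnomalousDissipation.AnomalousDissipation.Theorems.SolenoidalFractalHomogenisationLagrangianStepOneLevelSplitDefsW7
import Summits.AnomalousDissipation.AnomalousDissipation.Theorems.IsotropicCubatureWord

/-!
# W7 · the two registry-v7 stubs are ONE theorem (p5 g10, memo `Lines/onelevel-W7-engine.md` §1) — kernel check of the reduction

`ClassDecayAll` below is the statement the W7 seat actually proves (memo §2, S1–S4); `compactRange_of_all` and `largeR_of_all` are
the registry-v7 texts of `stub_compactRange` / `stub_largeR` derived from it by `classDecayW_mono` (admissibility is only weakened:
`admCompact R₁ → admAll`, `admLarge 1 → admAll` are trivial).  0 sorry.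
-/

set_option linter.dupNamespace false
set_option linter.unusedVariables false  -- binder names kept identical to the registry-v7 stub texts (`hR₁` is genuinely unused: admCompact ⊆ admAll)

namespace Summit.AnomalousDissipation.AnomalousDissipation.Cruxes.LagrangianRenormalisationStep.W7Engine

open Summit.AnomalousDissipation.AnomalousDissipation.Theorems
open Summit.AnomalousDissipation.AnomalousDissipation.Theorems.SolenoidalFractalHomogenisation.LagrangianStep

/-- THE one W7 theorem (all classes at once): uniform (M′)-decay for the cubature word, every admissible window, all live fibres.
[conjecture-shaped target of the W7 seat; memo `Lines/onelevel-W7-engine.md` §2] -/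
def ClassDecayAll : Prop :=
  ∀ (M : ℝ) (hM : 0 < M) (lo hi Λ β : ℝ), 0 < lo → lo ≤ 1 → 1 ≤ hi → 1 < Λ → 0 ≤ β → ∀ Kb : ℝ, 1 ≤ Kb →
    ∃ CK : ℝ, 1 ≤ CK ∧ ∃ cK > (0:ℝ), ∃ ν₀ > (0:ℝ), ClassDecayW cubatureWord M hM lo hi Λ β ν₀ Kb CK cK admAll

/-- `stub_compactRange` (registry v7 text) from the one theorem. -/
theorem compactRange_of_all (hall : ClassDecayAll) (M : ℝ) (hM : 0 < M) (lo hi Λ β : ℝ) (hlo : 0 < lo) (hlo1 : lo ≤ 1)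
    (hhi : 1 ≤ hi) (hΛ : 1 < Λ) (hβ : 0 ≤ β) (Kb : ℝ) (hKb : 1 ≤ Kb) (R₁ : ℝ) (hR₁ : 1 ≤ R₁) :
    ∃ CK : ℝ, 1 ≤ CK ∧ ∃ cK > (0:ℝ), ∃ ν₀ > (0:ℝ),
      ClassDecayW cubatureWord M hM lo hi Λ β ν₀ Kb CK cK (admCompact R₁) := by
  obtain ⟨CK, hCK, cK, hcK, ν₀, hν₀, h⟩ := hall M hM lo hi Λ β hlo hlo1 hhi hΛ hβ Kb hKb
  exact ⟨CK, hCK, cK, hcK, ν₀, hν₀,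
    classDecayW_mono le_rfl le_rfl le_rfl (by linarith) (fun _ _ _ _ => trivial) h⟩

/-- `stub_largeR` (registry v7 text) from the one theorem, with `R₁ := 1`. -/
theorem largeR_of_all (hall : ClassDecayAll) (M : ℝ) (hM : 0 < M) (lo hi Λ β : ℝ) (hlo : 0 < lo) (hlo1 : lo ≤ 1)
    (hhi : 1 ≤ hi) (hΛ : 1 < Λ) (hβ : 0 ≤ β) (Kb : ℝ) (hKb : 1 ≤ Kb) :
    ∃ R₁ : ℝ, 1 ≤ R₁ ∧ ∃ CK : ℝ, 1 ≤ CK ∧ ∃ cK > (0:ℝ), ∃ ν₀ > (0:ℝ),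
      ClassDecayW cubatureWord M hM lo hi Λ β ν₀ Kb CK cK (admLarge R₁) := by
  obtain ⟨CK, hCK, cK, hcK, ν₀, hν₀, h⟩ := hall M hM lo hi Λ β hlo hlo1 hhi hΛ hβ Kb hKb
  exact ⟨1, le_rfl, CK, hCK, cK, hcK, ν₀, hν₀,
    classDecayW_mono le_rfl le_rfl le_rfl (by linarith) (fun _ _ _ _ => trivial) h⟩

end Summit.AnomalousDissipation.AnomalousDissipation.Cruxes.LagrangianRenormalisationStep.W7Engine
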